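/-
Copyright (c) 2026 the pub-hodgecm-mathlib formalisation cell (harness21).  Prover seat hodgecm-mathlib-K2Liu-p11 (g2), Track B «K2-LIT»,
#184♮ = hLiu418 = `stmt-HodgeConjecture-24832`; organ S2, σ8 S2-⊗ FILE 2b (LEAD F0P6-plan (g14) BATCH #14 (2) «2a → 2b → 2c»; my census 12:31:39Z ∕ 12:35Z).
THEOREMS ONLY (no `def`, no `instance`, no notation, no named-fact hypothesis, no `sorry`); GENERIC over a finite product of groups.
-/
import Summits.HodgeConjecture.HodgeConjecture.Theorems.K2LiuFiniteTranslatesTensorSeparation   -- ★ S2-⊗ FILE 2a (K2E5-p17): `exists_sum_prod_of_mulSingle_slices`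
import Mathlib.LinearAlgebra.FiniteDimensional.Lemmas
import Mathlib.LinearAlgebra.Dimension.Constructions
import Mathlib.Topology.Algebra.Monoid
import Mathlib.Analysis.Complex.Basic
import Mathlib.Algebra.Group.Pi.Lemmas
import HarnessLib

/-!
# Crux `HLiu418`, S2-⊗ FILE 2b: THE SLICE SPACES OF A `K`-FINITE SECTION ON A PRODUCT GROUP `Π i, G i` ARE FINITE-DIMENSIONAL, AND THEIR MEMBERS
# INHERIT THE ONE-FACTOR LAW, `K i`-FINITENESS AND CONTINUITY — the hypotheses of the separation lemma (FILE 2a) and the properties FILE 2c needs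

Cell `hodgecm-mathlib`, crux item hLiu418 = `stmt-HodgeConjecture-24832` (helper lane `--supports`, count-neutral).

GENERIC and CHARACTER-AGNOSTIC (instance = FILE 2c: `G w = archLocal … w` along ★ `archPiEquivCM`, `c w p = siegelDeltaCharacter (χ^M₂) s (archToAdelic (ι_w p))`,
`V ⊆ archDegPS` from `IsArchKFinite`, Iwasawa per place).  SETTING: a finite index type `ι`, groups `G i`, `A : (Π i, G i) → ℂ` lying in a finite-dimensional
space `V` of functions (BINDER (F): `V` stable under right translation by `Pi.mulSingle i k`, `k ∈ K i` — the FULL product compact `∏ K i`; BINDER (L): every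
`B ∈ V` obeys the one-factor left laws `B (mulSingle i p * g) = c i p * B g`, `p ∈ P i`, for ARBITRARY functions `c i : G i → ℂ`; BINDER (I): `G i = P i · K i`).
THE SLICE SPACE at `i`: `span {u ↦ B (x * mulSingle i u) : B ∈ V, x i = 1}`.
* §1 `mul_mulSingle_mul` ∕ `mul_mulSingle_mul_right` (the factor-`i` translations commute with `i`-trivial `x`), `continuous_mulSingle_pi`;
* §2 generators: `slice_mem_span`; LAW `law_of_mem_span` (every member obeys `f (p u) = c i p · f u`); `K i`-STABILITY `translate_mem_span` (so every member is
  `K i`-finite once the span is finite-dimensional); CONTINUITY `continuous_of_mem_span` (topological factors, `V ⊆` continuous functions);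
* §3 **`finiteDimensional_span_slices`** — under (F)(L)(I) the slice space is FINITE-DIMENSIONAL: restriction to `K i` is injective on it (law + Iwasawa) and lands in the
  span of the `d²` matrix-coefficient functions `k ↦ coord_l (R_k B_j)` of a basis `(B_j)` of `V`;
* §4 **`exists_sum_prod_of_separation`** (hypothesis-first in the separation lemma) and **`exists_sum_prod`** ∕ **`exists_sum_prod_continuous`** (docked on ★ FILE 2a
  `K2LiuFiniteTranslatesTensorSeparation.exists_sum_prod_of_mulSingle_slices`, K2E5-p17 (g7)): `A = Σ_r c_r · ∏_i b_{r,i}(g_i)` with every factor `b_{r,i}` in the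
  slice space at `i` — hence law-abiding, `K i`-finite, continuous.
References: [BorelJacquet1979, §4.1 (admissible ⇒ factorisable vectors)]; [Flath1979, §2]; [GanQiuTakeda2014, §5.6]; [Tan1999, §1].
HONEST LABEL: HC_CM is proved only modulo the 7 printed citations (2 remaining named inputs: hLiu418 = stmt-HodgeConjecture-24832,
h413 = stmt-HodgeConjecture-24833) until rung 0 closes; count-neutral helper, closes no socket.
-/

set_option autoImplicit false
set_option linter.dupNamespace false

noncomputable section

open Set

namespace Summit.HodgeConjecture.HodgeConjecture.Cruxes.HLiu418.K2LiuPiGroupSiegelSliceSpaces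

variable {ι : Type*} [DecidableEq ι] {G : ι → Type*} [∀ i, Group (G i)]

/-! ## §1  Factor translations commute with `i`-trivial elements -/

/-- `x · ι_i(p u) = ι_i(p) · (x · ι_i(u))` when `x i = 1`. [folklore] -/
theorem mul_mulSingle_mul {x : Π i, G i} {i : ι} (hx : x i = 1) (p u : G i) :
    x * Pi.mulSingle i (p * u) = Pi.mulSingle i p * (x * Pi.mulSingle i u) := by
  funext j
  by_cases hj : j = i
  · subst hj
    simp [hx]
  · simp [Pi.mulSingle_eq_of_ne hj]

/-- `x · ι_i(u k) = (x · ι_i(u)) · ι_i(k)`. [folklore] -/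
theorem mul_mulSingle_mul_right (x : Π i, G i) (i : ι) (u k : G i) :
    x * Pi.mulSingle i (u * k) = x * Pi.mulSingle i u * Pi.mulSingle i k := by
  rw [Pi.mulSingle_mul, mul_assoc]

/-- `x · ι_i(u)` has `i`-coordinate `u` when `x i = 1`. [folklore] -/
theorem mul_mulSingle_apply_self {x : Π i, G i} {i : ι} (hx : x i = 1) (u : G i) : (x * Pi.mulSingle i u) i = u := by
  simp [hx]

/-- `x · ι_i((x i)⁻¹)` is `i`-trivial (the `i`-trivial part of `x`). [folklore] -/
theorem mul_mulSingle_inv_apply_self (x : Π i, G i) (i : ι) : (x * Pi.mulSingle i (x i)⁻¹) i = 1 := by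
  simp

/-- `x = (x · ι_i((x i)⁻¹)) · ι_i(x i)`. [folklore] -/
theorem eq_trivialPart_mul_mulSingle (x : Π i, G i) (i : ι) : x = x * Pi.mulSingle i (x i)⁻¹ * Pi.mulSingle i (x i) := by
  rw [mul_assoc, ← Pi.mulSingle_mul, inv_mul_cancel, Pi.mulSingle_one, mul_one]

/-- `u ↦ ι_i(u)` is continuous (topological factors). [folklore] -/
theorem continuous_mulSingle_pi [∀ i, TopologicalSpace (G i)] (i : ι) : Continuous fun u : G i => (Pi.mulSingle i u : Π i, G i) := by
  refine continuous_pi fun j => ?_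
  by_cases hj : j = i
  · subst hj
    simp only [Pi.mulSingle_eq_same]
    exact continuous_id'
  · simp only [Pi.mulSingle_eq_of_ne hj]
    exact continuous_const

/-! ## §2  The slice space at `i`: generators, law, `K i`-stability, continuity -/

/-- A slice `u ↦ B (x · ι_i(u))` (`B ∈ V`, `x i = 1`) lies in the slice space. [BorelJacquet1979, §4.1] -/
theorem slice_mem_span (V : Submodule ℂ ((Π i, G i) → ℂ)) (i : ι) {B : (Π i, G i) → ℂ} (hB : B ∈ V) {x : Π i, G i} (hx : x i = 1) :
    (fun u => B (x * Pi.mulSingle i u)) ∈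
      Submodule.span ℂ {f : G i → ℂ | ∃ B ∈ V, ∃ x : Π i, G i, x i = 1 ∧ f = fun u => B (x * Pi.mulSingle i u)} :=
  Submodule.subset_span ⟨B, hB, x, hx, rfl⟩

/-- **EVERY MEMBER OF THE SLICE SPACE OBEYS THE FACTOR-`i` LAW** `f (p u) = c i p · f u` (`p ∈ P i`), when every `B ∈ V` obeys the left law along `ι_i`.
[Tan1999, §1] [BorelJacquet1979, §4.1] -/
theorem law_of_mem_span (V : Submodule ℂ ((Π i, G i) → ℂ)) (i : ι) (P : Set (G i)) (c : G i → ℂ)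
    (hVlaw : ∀ B ∈ V, ∀ p ∈ P, ∀ g : Π i, G i, B (Pi.mulSingle i p * g) = c p * B g) {f : G i → ℂ}
    (hf : f ∈ Submodule.span ℂ {f : G i → ℂ | ∃ B ∈ V, ∃ x : Π i, G i, x i = 1 ∧ f = fun u => B (x * Pi.mulSingle i u)})
    {p : G i} (hp : p ∈ P) (u : G i) : f (p * u) = c p * f u := by
  induction hf using Submodule.span_induction with
  | mem f hf =>
    obtain ⟨B, hB, x, hx, rfl⟩ := hf
    show B (x * Pi.mulSingle i (p * u)) = c p * B (x * Pi.mulSingle i u)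
    rw [mul_mulSingle_mul hx, hVlaw B hB p hp]
  | zero => simp
  | add f g _ _ hf hg => rw [Pi.add_apply, Pi.add_apply, hf, hg, mul_add]
  | smul a f _ hf => rw [Pi.smul_apply, Pi.smul_apply, hf, smul_eq_mul, smul_eq_mul, mul_left_comm]

/-- **THE SLICE SPACE IS RIGHT-`K i`-STABLE** (so each member is `K i`-finite once §3 holds): `V` right-`ι_i(K i)`-stable ⇒ `u ↦ f (u k)` stays in the span.
[BorelJacquet1979, §4.1] -/
theorem translate_mem_span (V : Submodule ℂ ((Π i, G i) → ℂ)) (i : ι) (K : Set (G i))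
    (hV : ∀ k ∈ K, ∀ B ∈ V, (fun g => B (g * Pi.mulSingle i k)) ∈ V) {f : G i → ℂ}
    (hf : f ∈ Submodule.span ℂ {f : G i → ℂ | ∃ B ∈ V, ∃ x : Π i, G i, x i = 1 ∧ f = fun u => B (x * Pi.mulSingle i u)})
    {k : G i} (hk : k ∈ K) :
    (fun u => f (u * k)) ∈ Submodule.span ℂ {f : G i → ℂ | ∃ B ∈ V, ∃ x : Π i, G i, x i = 1 ∧ f = fun u => B (x * Pi.mulSingle i u)} := by
  induction hf using Submodule.span_induction with
  | mem f hf =>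
    obtain ⟨B, hB, x, hx, rfl⟩ := hf
    refine Submodule.subset_span ⟨fun g => B (g * Pi.mulSingle i k), hV k hk B hB, x, hx, ?_⟩
    funext u
    show B (x * Pi.mulSingle i (u * k)) = B (x * Pi.mulSingle i u * Pi.mulSingle i k)
    rw [mul_mulSingle_mul_right]
  | zero => exact Submodule.zero_mem _
  | add f g _ _ hf hg => exact Submodule.add_mem _ hf hg
  | smul a f _ hf => exact Submodule.smul_mem _ a hf

/-- **MEMBERS OF THE SLICE SPACE ARE CONTINUOUS** when the factors are topological groups with continuous multiplication and `V` consists of continuous functions.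
[BorelJacquet1979, §4.1] -/
theorem continuous_of_mem_span [∀ i, TopologicalSpace (G i)] [∀ i, ContinuousMul (G i)] (V : Submodule ℂ ((Π i, G i) → ℂ)) (i : ι)
    (hVc : ∀ B ∈ V, Continuous B) {f : G i → ℂ}
    (hf : f ∈ Submodule.span ℂ {f : G i → ℂ | ∃ B ∈ V, ∃ x : Π i, G i, x i = 1 ∧ f = fun u => B (x * Pi.mulSingle i u)}) :
    Continuous f := by
  induction hf using Submodule.span_induction with
  | mem f hf =>
    obtain ⟨B, hB, x, _, rfl⟩ := hf
    exact (hVc B hB).comp (continuous_const.mul (continuous_mulSingle_pi i))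
  | zero => exact continuous_const
  | add f g _ _ hf hg => exact hf.add hg
  | smul a f _ hf => exact continuous_const.mul hf

/-! ## §3  Finite-dimensionality of the slice space -/

/-- Restriction to the subgroup `K i` is INJECTIVE on the slice space: a member vanishing on `K i` vanishes (law along `P i` + Iwasawa `G i = P i · K i`).
[Tan1999, §1] -/
theorem eq_zero_of_forall_mem_eq_zero (V : Submodule ℂ ((Π i, G i) → ℂ)) (i : ι) (P K : Set (G i)) (c : G i → ℂ)
    (hVlaw : ∀ B ∈ V, ∀ p ∈ P, ∀ g : Π i, G i, B (Pi.mulSingle i p * g) = c p * B g) (hI : ∀ g : G i, ∃ p ∈ P, ∃ k ∈ K, g = p * k)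
    {f : G i → ℂ}
    (hf : f ∈ Submodule.span ℂ {f : G i → ℂ | ∃ B ∈ V, ∃ x : Π i, G i, x i = 1 ∧ f = fun u => B (x * Pi.mulSingle i u)})
    (h0 : ∀ k ∈ K, f k = 0) : f = 0 := by
  funext g
  obtain ⟨p, hp, k, hk, rfl⟩ := hI g
  rw [law_of_mem_span V i P c hVlaw hf hp, h0 k hk, mul_zero, Pi.zero_apply]

/-- **THE SLICE SPACE IS FINITE-DIMENSIONAL** under (F) `V` finite-dimensional and right-`ι_i(K i)`-stable, (L) the factor-`i` law on `V`, (I) `G i = P i · K i`: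
the restriction to `K i` is injective on it and every restricted slice `k ↦ B(x · ι_i(k)) = (R_k B)(x)` is a combination of the `d²` coordinate functions
`k ↦ coord_l (R_k B_j)` of a basis of `V`. [BorelJacquet1979, §4.1] [Flath1979, §2] -/
theorem finiteDimensional_span_slices (V : Submodule ℂ ((Π i, G i) → ℂ)) [FiniteDimensional ℂ V] (i : ι) (P K : Set (G i)) (c : G i → ℂ)
    (hV : ∀ k ∈ K, ∀ B ∈ V, (fun g => B (g * Pi.mulSingle i k)) ∈ V)
    (hVlaw : ∀ B ∈ V, ∀ p ∈ P, ∀ g : Π i, G i, B (Pi.mulSingle i p * g) = c p * B g) (hI : ∀ g : G i, ∃ p ∈ P, ∃ k ∈ K, g = p * k) :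
    FiniteDimensional ℂ (Submodule.span ℂ {f : G i → ℂ | ∃ B ∈ V, ∃ x : Π i, G i, x i = 1 ∧ f = fun u => B (x * Pi.mulSingle i u)}) := by
  classical
  set W := Submodule.span ℂ {f : G i → ℂ | ∃ B ∈ V, ∃ x : Π i, G i, x i = 1 ∧ f = fun u => B (x * Pi.mulSingle i u)} with hW
  -- a basis of `V` and the right translations `R_k : V → V`, `k ∈ K`
  let bV := Module.finBasis ℂ V
  set d := Module.finrank ℂ V with hd
  have Rk : ∀ k ∈ K, ∃ R : V →ₗ[ℂ] V, ∀ B : V, ((R B : V) : (Π i, G i) → ℂ) = fun g => (B : (Π i, G i) → ℂ) (g * Pi.mulSingle i k) := by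
    intro k hk
    exact ⟨LinearMap.mk (AddHom.mk (fun B => ⟨fun g => (B : (Π i, G i) → ℂ) (g * Pi.mulSingle i k), hV k hk B.1 B.2⟩) (fun _ _ => rfl))
      (fun _ _ => rfl), fun B => rfl⟩
  choose R hR using Rk
  -- the finite family of coordinate functions, extended by `0` off `K`
  let m : Fin d × Fin d → (G i → ℂ) := fun lj k => if hk : k ∈ K then bV.coord lj.1 (R k hk (bV lj.2)) else 0
  let M : Submodule ℂ (G i → ℂ) := Submodule.span ℂ (Set.range m)
  haveI : FiniteDimensional ℂ M := FiniteDimensional.span_of_finite ℂ (Set.finite_range m)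
  -- the `K`-cut-off map `f ↦ 1_K · f` is linear and injective on `W`, with image in `M`
  let cut : (G i → ℂ) →ₗ[ℂ] (G i → ℂ) :=
    LinearMap.mk (AddHom.mk (fun f k => if k ∈ K then f k else 0) (fun f g => by funext k; by_cases hk : k ∈ K <;> simp [hk]))
      (fun a f => by funext k; by_cases hk : k ∈ K <;> simp [hk])
  have hcut_mem : ∀ f ∈ W, cut f ∈ M := by
    intro f hf
    induction hf using Submodule.span_induction with
    | mem f hf =>
      obtain ⟨B, hB, x, hx, rfl⟩ := hf
      -- `1_K(k) · B(x ι_i(k)) = Σ_{l,j} (coord_j B) · B_l(x) · m (l,j) (k)`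
      have key : cut (fun u => B (x * Pi.mulSingle i u)) =
          ∑ lj : Fin d × Fin d, ((bV.repr ⟨B, hB⟩) lj.2 * ((bV lj.1 : V) : (Π i, G i) → ℂ) x) • m lj := by
        funext k
        rw [Finset.sum_apply]
        simp only [Pi.smul_apply, smul_eq_mul]
        by_cases hk : k ∈ K
        · have hcut : cut (fun u => B (x * Pi.mulSingle i u)) k = B (x * Pi.mulSingle i k) := by
            show (if k ∈ K then B (x * Pi.mulSingle i k) else 0) = _
            rw [if_pos hk]
          have hm : ∀ lj : Fin d × Fin d, m lj k = bV.coord lj.1 (R k hk (bV lj.2)) := fun lj => by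
            show (if hk : k ∈ K then bV.coord lj.1 (R k hk (bV lj.2)) else 0) = _
            rw [dif_pos hk]
          rw [hcut]
          simp_rw [hm]
          -- expand `R_k B` in the basis and evaluate at `x`
          have h1 : B (x * Pi.mulSingle i k) = ((R k hk ⟨B, hB⟩ : V) : (Π i, G i) → ℂ) x := (congrFun (hR k hk ⟨B, hB⟩) x).symm
          have hexp : (R k hk ⟨B, hB⟩ : V) = ∑ l : Fin d, bV.coord l (R k hk ⟨B, hB⟩) • bV l := (bV.sum_repr _).symm
          have hval : B (x * Pi.mulSingle i k) = ∑ l : Fin d, bV.coord l (R k hk ⟨B, hB⟩) * ((bV l : V) : (Π i, G i) → ℂ) x := by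
            conv_lhs => rw [h1, hexp]
            rw [Submodule.coe_sum, Finset.sum_apply]
            refine Finset.sum_congr rfl fun l _ => ?_
            rw [Submodule.coe_smul, Pi.smul_apply, smul_eq_mul]
          -- linearity of `B ↦ coord_l (R_k B)` in `B`
          have hB' : (⟨B, hB⟩ : V) = ∑ j : Fin d, (bV.repr ⟨B, hB⟩) j • bV j := (bV.sum_repr _).symm
          have hlin : ∀ l : Fin d, bV.coord l (R k hk ⟨B, hB⟩) = ∑ j : Fin d, (bV.repr ⟨B, hB⟩) j * bV.coord l (R k hk (bV j)) := by
            intro l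
            have hR' : R k hk ⟨B, hB⟩ = ∑ j : Fin d, (bV.repr ⟨B, hB⟩) j • R k hk (bV j) := by
              conv_lhs => rw [hB']
              rw [map_sum]
              exact Finset.sum_congr rfl fun j _ => map_smul _ _ _
            rw [hR', map_sum]
            exact Finset.sum_congr rfl fun j _ => by rw [map_smul, smul_eq_mul]
          rw [hval, Fintype.sum_prod_type]
          refine Finset.sum_congr rfl fun l _ => ?_
          rw [hlin l, Finset.sum_mul]
          exact Finset.sum_congr rfl fun j _ => by ring
        · have hcut : cut (fun u => B (x * Pi.mulSingle i u)) k = 0 := by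
            show (if k ∈ K then B (x * Pi.mulSingle i k) else 0) = 0
            rw [if_neg hk]
          have hm : ∀ lj : Fin d × Fin d, m lj k = 0 := fun lj => by
            show (if hk : k ∈ K then bV.coord lj.1 (R k hk (bV lj.2)) else 0) = 0
            rw [dif_neg hk]
          rw [hcut]
          simp_rw [hm, mul_zero, Finset.sum_const_zero]
      rw [key]
      exact Submodule.sum_mem _ fun lj _ => Submodule.smul_mem _ _ (Submodule.subset_span ⟨lj, rfl⟩)
    | zero => rw [map_zero]; exact Submodule.zero_mem _
    | add f g _ _ hf hg => rw [map_add]; exact Submodule.add_mem _ hf hg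
    | smul a f _ hf => rw [map_smul]; exact Submodule.smul_mem _ a hf
  -- the restricted map `W → M` is injective
  let T : W →ₗ[ℂ] M := LinearMap.mk (AddHom.mk (fun f => ⟨cut f, hcut_mem f f.2⟩) (fun f g => Subtype.ext (map_add cut f.1 g.1)))
    (fun a f => Subtype.ext (map_smul cut a f.1))
  have hT : Function.Injective T := by
    intro f g hfg
    apply Subtype.ext
    have h : cut (f - g : W) = 0 := by
      have := congrArg Subtype.val hfg
      simp only [T, LinearMap.coe_mk, AddHom.coe_mk] at this
      rw [Submodule.coe_sub, map_sub, this, sub_self]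
    have h0 : ∀ k ∈ K, ((f - g : W) : G i → ℂ) k = 0 := fun k hk => by
      have := congrFun h k
      simpa [cut, hk] using this
    have := eq_zero_of_forall_mem_eq_zero V i P K c hVlaw hI (f - g).2 h0
    rwa [Submodule.coe_sub, sub_eq_zero] at this
  exact Module.Finite.of_injective T hT

/-! ## §4  The end head, hypothesis-first in the separation lemma (FILE 2a) -/

/-- **SUM-OF-PRODUCTS DECOMPOSITION OF A `K`-FINITE SECTION ON `Π i, G i`.**  Under (F)(L)(I), and GIVEN the separation lemma of FILE 2a as the binder `hsep`
(«a function whose `i`-slices through `i`-trivial base points lie in finite-dimensional `W i` for every `i` is `Σ_r c_r ∏_i b_{r,i}(g_i)` with `b_{r,i} ∈ W i`»),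
`A` is a finite sum of products of one-factor functions, each obeying the factor law, `K i`-finite (its right `K i`-translates stay in the finite-dimensional
slice space) — and continuous when `V` consists of continuous functions (`continuous_of_mem_span`). [BorelJacquet1979, §4.1] [Flath1979, §2] [GanQiuTakeda2014, §5.6] -/
theorem exists_sum_prod_of_separation [Fintype ι] (V : Submodule ℂ ((Π i, G i) → ℂ)) [FiniteDimensional ℂ V] (P K : ∀ i, Set (G i)) (c : ∀ i, G i → ℂ)
    (hV : ∀ i, ∀ k ∈ K i, ∀ B ∈ V, (fun g => B (g * Pi.mulSingle i k)) ∈ V)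
    (hVlaw : ∀ B ∈ V, ∀ i, ∀ p ∈ P i, ∀ g : Π i, G i, B (Pi.mulSingle i p * g) = c i p * B g)
    (hI : ∀ i, ∀ g : G i, ∃ p ∈ P i, ∃ k ∈ K i, g = p * k) {A : (Π i, G i) → ℂ} (hA : A ∈ V)
    (hsep : ∀ (W : ∀ i, Submodule ℂ (G i → ℂ)), (∀ i, FiniteDimensional ℂ (W i)) →
      (∀ (i : ι) (x : Π i, G i), x i = 1 → (fun u => A (x * Pi.mulSingle i u)) ∈ W i) →
      ∃ (m : ℕ) (cr : Fin m → ℂ) (b : Fin m → ∀ i, (G i → ℂ)), (∀ r i, b r i ∈ W i) ∧ ∀ g, A g = ∑ r, cr r * ∏ i, b r i (g i)) :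
    ∃ (m : ℕ) (cr : Fin m → ℂ) (b : Fin m → ∀ i, (G i → ℂ)),
      (∀ r i, ∀ p ∈ P i, ∀ u, b r i (p * u) = c i p * b r i u) ∧
      (∀ r i, ∀ k ∈ K i, (fun u => b r i (u * k)) ∈
        Submodule.span ℂ {f : G i → ℂ | ∃ B ∈ V, ∃ x : Π i, G i, x i = 1 ∧ f = fun u => B (x * Pi.mulSingle i u)}) ∧
      (∀ r i, b r i ∈ Submodule.span ℂ {f : G i → ℂ | ∃ B ∈ V, ∃ x : Π i, G i, x i = 1 ∧ f = fun u => B (x * Pi.mulSingle i u)}) ∧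
      ∀ g, A g = ∑ r, cr r * ∏ i, b r i (g i) := by
  have hfd : ∀ i, FiniteDimensional ℂ (Submodule.span ℂ {f : G i → ℂ | ∃ B ∈ V, ∃ x : Π i, G i, x i = 1 ∧ f = fun u => B (x * Pi.mulSingle i u)}) :=
    fun i => finiteDimensional_span_slices V i (P i) (K i) (c i) (hV i) (fun B hB p hp g => hVlaw B hB i p hp g) (hI i)
  obtain ⟨m, cr, b, hb, hsum⟩ := hsep _ hfd fun i x hx => slice_mem_span V i hA hx
  exact ⟨m, cr, b, fun r i p hp u => law_of_mem_span V i (P i) (c i) (fun B hB p hp g => hVlaw B hB i p hp g) (hb r i) hp u,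
    fun r i k hk => translate_mem_span V i (K i) (hV i) (hb r i) hk, hb, hsum⟩

/-- **THE SAME, BINDER-FREE**: docked on ★ S2-⊗ FILE 2a `K2LiuFiniteTranslatesTensorSeparation.exists_sum_prod_of_mulSingle_slices` (K2E5-p17 (g7), p860234).
[BorelJacquet1979, §4.1] [Flath1979, §2] [GanQiuTakeda2014, §5.6] -/
theorem exists_sum_prod [Fintype ι] (V : Submodule ℂ ((Π i, G i) → ℂ)) [FiniteDimensional ℂ V] (P K : ∀ i, Set (G i)) (c : ∀ i, G i → ℂ)
    (hV : ∀ i, ∀ k ∈ K i, ∀ B ∈ V, (fun g => B (g * Pi.mulSingle i k)) ∈ V)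
    (hVlaw : ∀ B ∈ V, ∀ i, ∀ p ∈ P i, ∀ g : Π i, G i, B (Pi.mulSingle i p * g) = c i p * B g)
    (hI : ∀ i, ∀ g : G i, ∃ p ∈ P i, ∃ k ∈ K i, g = p * k) {A : (Π i, G i) → ℂ} (hA : A ∈ V) :
    ∃ (m : ℕ) (cr : Fin m → ℂ) (b : Fin m → ∀ i, (G i → ℂ)),
      (∀ r i, ∀ p ∈ P i, ∀ u, b r i (p * u) = c i p * b r i u) ∧
      (∀ r i, ∀ k ∈ K i, (fun u => b r i (u * k)) ∈
        Submodule.span ℂ {f : G i → ℂ | ∃ B ∈ V, ∃ x : Π i, G i, x i = 1 ∧ f = fun u => B (x * Pi.mulSingle i u)}) ∧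
      (∀ r i, b r i ∈ Submodule.span ℂ {f : G i → ℂ | ∃ B ∈ V, ∃ x : Π i, G i, x i = 1 ∧ f = fun u => B (x * Pi.mulSingle i u)}) ∧
      ∀ g, A g = ∑ r, cr r * ∏ i, b r i (g i) :=
  exists_sum_prod_of_separation V P K c hV hVlaw hI hA fun W hW hslice => by
    haveI : ∀ i, FiniteDimensional ℂ (W i) := hW
    exact K2LiuFiniteTranslatesTensorSeparation.exists_sum_prod_of_mulSingle_slices W A hslice

/-- **WITH CONTINUITY**: if moreover the factors are topological groups with continuous multiplication and `V` consists of continuous functions, all the factors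
`b r i` are continuous. [BorelJacquet1979, §4.1] -/
theorem exists_sum_prod_continuous [Fintype ι] [∀ i, TopologicalSpace (G i)] [∀ i, ContinuousMul (G i)] (V : Submodule ℂ ((Π i, G i) → ℂ))
    [FiniteDimensional ℂ V] (P K : ∀ i, Set (G i)) (c : ∀ i, G i → ℂ)
    (hV : ∀ i, ∀ k ∈ K i, ∀ B ∈ V, (fun g => B (g * Pi.mulSingle i k)) ∈ V)
    (hVlaw : ∀ B ∈ V, ∀ i, ∀ p ∈ P i, ∀ g : Π i, G i, B (Pi.mulSingle i p * g) = c i p * B g)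
    (hI : ∀ i, ∀ g : G i, ∃ p ∈ P i, ∃ k ∈ K i, g = p * k) (hVc : ∀ B ∈ V, Continuous B) {A : (Π i, G i) → ℂ} (hA : A ∈ V) :
    ∃ (m : ℕ) (cr : Fin m → ℂ) (b : Fin m → ∀ i, (G i → ℂ)),
      (∀ r i, ∀ p ∈ P i, ∀ u, b r i (p * u) = c i p * b r i u) ∧
      (∀ r i, ∀ k ∈ K i, (fun u => b r i (u * k)) ∈
        Submodule.span ℂ {f : G i → ℂ | ∃ B ∈ V, ∃ x : Π i, G i, x i = 1 ∧ f = fun u => B (x * Pi.mulSingle i u)}) ∧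
      (∀ r i, Continuous (b r i)) ∧
      ∀ g, A g = ∑ r, cr r * ∏ i, b r i (g i) := by
  obtain ⟨m, cr, b, hlaw, htr, hmem, hsum⟩ := exists_sum_prod V P K c hV hVlaw hI hA
  exact ⟨m, cr, b, hlaw, htr, fun r i => continuous_of_mem_span V i hVc (hmem r i), hsum⟩

end Summit.HodgeConjecture.HodgeConjecture.Cruxes.HLiu418.K2LiuPiGroupSiegelSliceSpaces

end
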